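import Mathlib.CategoryTheory.Types.Basic
import Literature.AnabelianGeometry.AbsoluteAnabelian.LogFrobeniusLogWallIndependence
import HarnessLib

/-!
# Schema closure (LABEL-CHECK refuter) for `LogFrobeniusSetting.CompatibleIn` (F-0137)

PROOF-ONLY companion (cell abc-iut, block F, seat abc-iut-f-052 gen 13; abc-iut-F-lit's LABEL-CHECK list
`plan/LF-REFUTED-WITHOUT-REFUTER.tsv`, 2026-08-27T06:06Z: «a REFUTED label should name a kernel `¬∀` of
record»), importing — never editing — `LogFrobeniusCorollaries.lean` (S. Mochizuki, *Topics in Absolute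
Anabelian Geometry III* (2015) [AbsTopIII], Cor 5.5 (iv) p. 131 with Def 3.5 (ii) p. 75, "compatible
families of homotopies") and abc-iut-L4's diagonal-setting toolkit `LogFrobeniusLogWallIndependence.lean`.
`CompatibleIn K H` is a RELATION between a family of homotopies `H` on a presentation `D•_{≤P} ∪ {x}` and a
family `K` on `D•⊢` (plan header rule R1 (ii)/R5: a schema; its universal closure is not a fact).  The
closure is FALSE by a closed kernel witness at the (degenerate, calibration-only) DIAGONAL setting: the
EMPTY family on `D•⊢` (`strictFamily` of the empty boundary set — saturated vacuously) receives no boundary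
pair of the non-empty strict-commutation family `diagonalObsFamily P x` (which contains `(id_x, id_x)`) —
`not_compatibleIn_empty_diagonalObsFamily`, `not_forall_compatibleIn`.  Instance forms of record that HOLD:
`diagonalObsFamily_compatibleIn` (same file as the toolkit), `obsRestrict_compatibleIn`
(`LogFrobeniusRealisesSufficiency.lean`).
HONEST FRAMING: a statement about OUR typed schema (refuted-as-typed-∀ ≠ refuted-in-print; the instance
forms the cone consumes are untouched); the diagonal setting has no arithmetic content by design; nothing
here bears on [IUTchIII] Cor 3.12; typed ≠ proved; nothing here asserts abc proved or refuted.
-/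

universe v u w

namespace Literature.AnabelianGeometry.AbsoluteAnabelian

open CategoryTheory Quiver

/-- The EMPTY boundary set is saturated (all closure conditions are vacuous), so every diagram of
categories carries the empty family of homotopies. [cite: MochizukiAbsTopIII2015, Definition 3.5 (ii) p.75] -/
theorem isSaturated_empty {V : Type w} [Quiver.{v} V] :
    IsSaturated (V := V) (fun _ _ _ _ => False) where
  refl_left _ _ _ _ h := h.elim
  refl_right _ _ _ _ h := h.elim
  trans _ _ _ _ _ h _ := h.elim
  precomp _ _ _ _ _ h _ := h.elim
  postcomp _ _ _ _ _ h _ := h.elim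

namespace LogFrobeniusSetting

variable (Vmod : Type u) (isArc : Vmod → Bool) (C : Type (u + 1)) [Category.{u} C]

/-- **Empty-family witness at the diagonal setting.**  The strict-commutation family `diagonalObsFamily P x`
on `D•_{≤P} ∪ {x}` contains the boundary pair `(id_x, id_x)`, which has no image in the EMPTY family of
homotopies on `D•⊢`: the two families are NOT compatible in the sense of Def 3.5 (ii) / Cor 5.5 (iv).
[cite: MochizukiAbsTopIII2015, Cor 5.5 (iv) p. 131] -/
theorem not_compatibleIn_empty_diagonalObsFamily (P : DVertex Vmod isArc → Prop) (x : DVertex Vmod isArc) :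
    ¬ (diagonal Vmod isArc C).CompatibleIn
        ((diagonal Vmod isArc C).diagram.strictFamily (fun _ _ _ _ => False) isSaturated_empty
          (by intro _ _ _ _ h; exact h.elim))
        (diagonalObsFamily Vmod isArc C P x) := by
  intro h
  obtain ⟨h', -⟩ :=
    h (Path.nil : Path (obsShape P x).obs (obsShape P x).obs) Path.nil (rfl : (obsShape P x).obs = _)
  exact h'

/-- **F-0137, universal closure REFUTED** (kernel `¬∀` of record for the LABEL-CHECK list): it is false
that every family of homotopies on a presentation `D•_{≤P} ∪ {x}` is compatible with every family on `D•⊢`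
— witness: the diagonal setting over `C = Type`, one nonarchimedean place, `P = ⊤`, `x = □`, the empty
family on `D•⊢`.  Schema row; consumable AT NAMED INSTANCES ONLY (`diagonalObsFamily_compatibleIn`,
`obsRestrict_compatibleIn` are the instance forms of record). [cite: MochizukiAbsTopIII2015, Cor 5.5 (iv) p. 131] -/
theorem not_forall_compatibleIn :
    ¬ ∀ (Vmod : Type) (isArc : Vmod → Bool) (L : LogFrobeniusSetting.{0} Vmod isArc)
        (K : L.diagram.HomotopyFamily) (P : DVertex Vmod isArc → Prop) (x : DVertex Vmod isArc)
        (H : ((L.subdiagram P).extend (L.obsExt P x)).HomotopyFamily),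
        Literature.AnabelianGeometry.AbsoluteAnabelian.LogFrobeniusSetting.CompatibleIn L K H := fun h =>
  not_compatibleIn_empty_diagonalObsFamily PUnit (fun _ => false) (Type) (fun _ => True) DVertex.core
    (h _ _ _ _ _ _ _)

end LogFrobeniusSetting

end Literature.AnabelianGeometry.AbsoluteAnabelian
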